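import Literature.Geometry.Kaehler.ComplexTorusIntermediateJacobianFourier
import Literature.Geometry.Kaehler.ComplexTorusFourierInversion
import HarnessLib

/-!
# The inversion theorem on the lattices and on the intermediate Jacobians of a complex torus:
# `F_X̂ · F_X = (-1)^g · 1`, `F_X̂ = (-1)^g ᵗF_X`, `J(F_X̂) ∘ J(F_X) = ρ((-1)^g · 1)` (Lange 2023, Thm. 6.2.15)

Layer `Literature/Geometry/Kaehler`, namespace `Literature.Geometry.Kaehler.ComplexTorus` (lane `lit-hodgefound`,
Layer A; prover seat `lit-hodgefound-p26`, gen 6). Sequel of this seat's `ComplexTorusIntermediateJacobianFourier.lean`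
(g6-#4: the integer matrix `fourierMatrix Φ e` of `F_X : Hᵖ(X) → Hᵐ(X̂)` in the lattice monomial bases, unimodular
with inverse `ᵗ(fourierMatrix Φ e)`; `J_G(F_X) : J_G^q(X) ≅ J_G^{g-q+1}(X̂)`) and of row A4-33⁺⁵
`ComplexTorusFourierInversion.lean` (prover p08: Thm. 6.2.15 on invariant forms,
`fourierForm_fourierForm_latMonomial : F_X̂(F_X(dx_t)) = (-1)^g dẑ_t` with `dẑ_t` the same monomial in the lattice
coordinates of `X̂̂`, `X̂̂ = X` through double antiduality `κ`, `realRep_one_eq_toDoubleAntidual`).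

## Sources, verbatim

* H. Lange, *Abelian Varieties over the Complex Numbers* (Springer 2023), held text
  `book:lange1992-complex-abelian-varieties`, §6.2.3 p0307 L9–L11: "**Theorem 6.2.15 (Inversion Theorem)**
  `F_X̂ F_X = (-1)^g (-1)_X^* : Ch(X)_ℚ → Ch(X)_ℚ`."; L21: "**Corollary 6.2.16** The Fourier transform
  `F_X : Ch(X)_ℚ → Ch(X̂)_ℚ` is bijective"; §6.2.4 p0309: "By definition we have `F ∘ cl = cl ∘ F`"; p0310
  Prop. 6.2.20: "`F|_{Hᵖ(X,ℤ)} = (-1)^{g+½p(p+1)} α_p : Hᵖ(X,ℤ) → H^{2g-p}(X̂,ℤ)`" (integrality).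
* A. Beauville, *Quelques remarques sur la transformation de Fourier dans l'anneau de Chow d'une variété
  abélienne*, LNM 1016 (1983), Prop. 3 (i): "`F_Â ∘ F_A = (-1)^g (-1_A)^*`".
* C. Voisin, *Hodge Theory and Complex Algebraic Geometry I* (CUP 2002), §12.1.1 p0240 Rem. 12.3 (`J` is a functor
  on morphisms of Hodge structures of bidegree `(r, r)` mapping lattices to lattices).

## What is proved (`X = E/Φ(ℤ^ι)` of dimension `g`, `e : Fin (p + m) ≃ ι`, `e′ : Fin (m + p) ≃ ι`, `g + g = p + m`;
## `F_X = fourierMatrix Φ e`, `F_X̂ = fourierMatrix (dualPeriod Φ) e′` — the latter in the bases `(dx̂_J)` of `Hᵐ(X̂, ℤ)`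
## and `(dẑ_I)` of `Hᵖ(X̂̂, ℤ)`, the SAME index sets as `(dx_I)`: the canonical `κ : X ⥲ X̂̂` has `ρ_r(κ) = 1`)

* §1 on the LATTICES: **`fourierMatrix_dualPeriod_mul_fourierMatrix`** — `F_X̂ · F_X = (-1)^g · 1` (Thm. 6.2.15 as an
  identity of integer matrices; the tree's `κ` absorbs Lange's `(-1)_X^*`, cf. row A4-33⁺⁵'s docstring), from p08's
  monomial formula through `toMatrix` and the injectivity of `ℤ → ℚ → ℂ`; **`fourierMatrix_dualPeriod_eq`** —
  `F_X̂ = (-1)^g ᵗF_X` (with g6-#4's `F_X ᵗF_X = 1`): the Fourier matrix of the dual torus is the transpose of that of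
  `X` up to `(-1)^g`; `fourierMatrix_mul_fourierMatrix_dualPeriod` — `F_X · F_X̂ = (-1)^g · 1` as well.
* §2 on the GRIFFITHS Jacobians (`p = 2q - 1`): **`mapMatrix_griffithsPeriod_fourierMatrix_dualPeriod_fourierMatrix`** —
  `J_G(F_X̂) ∘ J_G(F_X) = ρ((-1)^g · 1) : J_G^q(X) → J_G^q(X̂̂)` (levels `q ↦ q + (g-p) ↦ q + (g-p) + (g-m)`), the
  functor `J_G` of Rem. 12.3 applied to Thm. 6.2.15; §3 the same on WEIL's Jacobians,
  `mapMatrix_weilMinusCPeriod_fourierMatrix_dualPeriod_fourierMatrix`.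

Theorems only; no definition, no named fact. Row A4-33⁺⁵ (`fourierForm_fourierForm_latMonomial`,
`orientationSign_dualPeriod`) and g6-#4 (`fourierMatrix`, `toMatrix_fourierForms_eq_fourierMatrix`,
`fourierMatrix_mul_transpose_self`, `fourierLevel_eq`) are consumed BY NAME.

## References

* [Lange2023AbelianVarietiesComplex] H. Lange, Abelian Varieties over the Complex Numbers, Springer 2023, §6.2.3
  Thm. 6.2.15, Cor. 6.2.16 (p. 307); §6.2.4 Prop. 6.2.20 (p. 310).
* [Beauville1983FourierChow] A. Beauville, Quelques remarques sur la transformation de Fourier dans l'anneau de Chow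
  d'une variété abélienne, LNM 1016 (1983), Prop. 3 (i).
* [VoisinHodgeI2002] C. Voisin, Hodge Theory and Complex Algebraic Geometry I, CUP 2002, §12.1.1 Rem. 12.3 (PDF p. 240).
-/

noncomputable section

-- Nested instance problems on the carriers `↥(rationalForms Φ k)` (as in the sibling A1-25 / A1-29 files).
set_option maxSynthPendingDepth 3

open scoped TensorProduct Manifold ContDiff Matrix
open Module Function
open Literature.AlgebraicGeometry.Motives Literature.AlgebraicGeometry.Motives.HodgeStructure
open Literature.AlgebraicGeometry.HodgeTheory
open Literature.LinearAlgebra.Alternating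

namespace Literature.Geometry.Kaehler

namespace ComplexTorus

universe uι uE

variable {ι : Type uι} {E : Type uE} [NormedAddCommGroup E] [NormedSpace ℂ E] (Φ : (ι → ℝ) ≃L[ℝ] E)
  [Fintype ι] [LinearOrder ι] {p m g : ℕ} (e : Fin (p + m) ≃ ι) (e' : Fin (m + p) ≃ ι) (hg : g + g = p + m)

/-! ## §1 Theorem 6.2.15 on the lattices: `F_X̂ · F_X = (-1)^g · 1` -/

section Lattice

include Φ e hg in
omit [LinearOrder ι] in
/-- `g = dim_ℂ X` (`2 dim_ℂ E = rank Λ = p + m`). [cite: Lange2023AbelianVarietiesComplex, §1.1.4 Prop. 1.1.20] -/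
theorem finrank_eq_of_add_self_eq : Module.finrank ℂ E = g := by
  have h := finrank_complex_mul_two Φ e
  omega

omit [Fintype ι] [LinearOrder ι] [NormedAddCommGroup E] [NormedSpace ℂ E] in
/-- `ℤ → ℚ` is multiplicative on rectangular matrices. Private: cast plumbing. [folklore] -/
private theorem map_intCast_mul₇ {α β γ : Type*} [Fintype β] (M : Matrix α β ℤ) (N : Matrix β γ ℤ) :
    (M * N).map (Int.cast : ℤ → ℚ) = M.map (Int.cast : ℤ → ℚ) * N.map (Int.cast : ℤ → ℚ) := by
  ext i j
  simp [Matrix.mul_apply]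

/-- **The entries of `F_X̂ · F_X` with complex coefficients**: the `dẑ_J`-coordinate of `F_X̂(F_X(dx_I))` is
`(-1)^g δ_{J,I}` (p08's `F_X̂(F_X(dx_I)) = (-1)^g dẑ_I`). [cite: Lange2023AbelianVarietiesComplex, §6.2.3 Thm. 6.2.15 (p. 307)]
[cite: Beauville1983FourierChow, Prop. 3 (i)] -/
theorem ratCast_toMatrix_fourierForms_comp_fourierForms (J I : {w : Fin p → ι // StrictMono w}) :
    ((LinearMap.toMatrix (monomialBasis Φ p) (monomialBasis (dualPeriod (dualPeriod Φ)) p)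
        (fourierForms (dualPeriod Φ) e' ∘ₗ fourierForms Φ e) J I : ℚ) : ℂ) =
      (-1 : ℂ) ^ Module.finrank ℂ E * (if I = J then 1 else 0) := by
  rw [LinearMap.toMatrix_apply, ratCast_monomialBasis_repr, LinearMap.comp_apply, coe_fourierForms_apply,
    coe_fourierForms_apply, coe_monomialBasis, fourierForm_fourierForm_latMonomial Φ e e' I.1 I.2,
    ContinuousAlternatingMap.smul_apply, latMonomial_apply_single_eq_ite (dualPeriod (dualPeriod Φ)) I J,
    smul_eq_mul]

include hg in
/-- **Theorem 6.2.15 (Inversion) on the lattices: `F_X̂ · F_X = (-1)^g · 1`** as INTEGER matrices in the lattice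
monomial bases `(dx_I)` of `Hᵖ(X, ℤ)`, `(dx̂_J)` of `Hᵐ(X̂, ℤ)`, `(dẑ_I)` of `Hᵖ(X̂̂, ℤ)` (the canonical `κ : X ⥲ X̂̂`,
`ρ_r(κ) = 1`, identifies `dẑ_I` with `dx_I`; with Lange's `-κ` one reads `(-1)^g (-1)_X^*`).
[cite: Lange2023AbelianVarietiesComplex, §6.2.3 Thm. 6.2.15 (p. 307)] [cite: Beauville1983FourierChow, Prop. 3 (i)] -/
theorem fourierMatrix_dualPeriod_mul_fourierMatrix :
    fourierMatrix (dualPeriod Φ) e' * fourierMatrix Φ e = (-1) ^ g • (1 : Matrix _ _ ℤ) := by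
  have hM : LinearMap.toMatrix (monomialBasis Φ p) (monomialBasis (dualPeriod (dualPeriod Φ)) p)
      (fourierForms (dualPeriod Φ) e' ∘ₗ fourierForms Φ e) =
        (fourierMatrix (dualPeriod Φ) e' * fourierMatrix Φ e).map (Int.cast : ℤ → ℚ) := by
    rw [LinearMap.toMatrix_comp _ (monomialBasis (dualPeriod Φ) m), toMatrix_fourierForms_eq_fourierMatrix,
      toMatrix_fourierForms_eq_fourierMatrix, map_intCast_mul₇]
  have h2 : (fourierMatrix (dualPeriod Φ) e' * fourierMatrix Φ e).map (Int.cast : ℤ → ℚ) =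
      ((-1) ^ g • (1 : Matrix {w : Fin p → ι // StrictMono w} {w : Fin p → ι // StrictMono w} ℤ)).map
        (Int.cast : ℤ → ℚ) := by
    rw [← hM]
    ext J I
    apply Rat.cast_injective (α := ℂ)
    rw [ratCast_toMatrix_fourierForms_comp_fourierForms, finrank_eq_of_add_self_eq Φ e hg, Matrix.map_apply,
      Matrix.smul_apply, Matrix.one_apply]
    split_ifs with h h' h'
    · simp
    · exact absurd h.symm h'
    · exact absurd h'.symm h
    · simp
  exact Matrix.map_injective (fun _ _ hab ↦ Int.cast_injective (α := ℚ) hab) h2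

omit [LinearOrder ι] [Fintype ι] [NormedAddCommGroup E] [NormedSpace ℂ E] in
/-- `((-1)^g)² = 1` in `ℤ`. [folklore] -/
private theorem neg_one_pow_mul_self₇ (g : ℕ) : ((-1 : ℤ) ^ g) * (-1) ^ g = 1 := by
  rw [← pow_add, ← two_mul, pow_mul, neg_one_sq, one_pow]

include hg in
/-- **`F_X̂ = (-1)^g ᵗF_X` on the lattices**: the Fourier matrix of the dual torus (bases `(dx̂_J)`, `(dẑ_I)`) is the
transpose of the Fourier matrix of `X` up to `(-1)^g` (`F_X̂ F_X = (-1)^g` and `F_X ᵗF_X = 1`, g6-#4: so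
`F_X⁻¹ = ᵗF_X = (-1)^g F_X̂` — Cor. 6.2.16 "`F_X` is bijective" with its inverse).
[cite: Lange2023AbelianVarietiesComplex, §6.2.3 Thm. 6.2.15 / Cor. 6.2.16 (p. 307)] -/
theorem fourierMatrix_dualPeriod_eq :
    fourierMatrix (dualPeriod Φ) e' = (-1) ^ g • (fourierMatrix Φ e)ᵀ := by
  calc fourierMatrix (dualPeriod Φ) e'
      = fourierMatrix (dualPeriod Φ) e' * (fourierMatrix Φ e * (fourierMatrix Φ e)ᵀ) := by
        rw [fourierMatrix_mul_transpose_self, Matrix.mul_one]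
    _ = (-1) ^ g • (fourierMatrix Φ e)ᵀ := by
        rw [← Matrix.mul_assoc, fourierMatrix_dualPeriod_mul_fourierMatrix Φ e e' hg, Matrix.smul_mul,
          Matrix.one_mul]

include hg in
/-- **`F_X · F_X̂ = (-1)^g · 1`** as well (`F_X̂ = (-1)^g ᵗF_X` and `ᵗF_X F_X = 1`).
[cite: Lange2023AbelianVarietiesComplex, §6.2.3 Thm. 6.2.15 (p. 307)] -/
theorem fourierMatrix_mul_fourierMatrix_dualPeriod :
    fourierMatrix Φ e * fourierMatrix (dualPeriod Φ) e' = (-1) ^ g • (1 : Matrix _ _ ℤ) := by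
  rw [fourierMatrix_dualPeriod_eq Φ e e' hg, Matrix.mul_smul, fourierMatrix_mul_transpose_self]

end Lattice

/-! ## §2 Theorem 6.2.15 on the Griffiths intermediate Jacobians -/

section Griffiths

variable (q : ℤ) (hq : q + q = (p : ℤ) + 1)

include hg in
omit [Fintype ι] [LinearOrder ι] in
/-- Index bookkeeping: `g + g = m + p` for the second transform `F_X̂ : Hᵐ(X̂) → Hᵖ(X̂̂)`.
[cite: VoisinHodgeI2002, §12.1.1 Rem. 12.3 (PDF p. 240)] -/
theorem add_self_eq_swap : g + g = m + p := by omega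

/-- **Theorem 6.2.15 on the Griffiths intermediate Jacobians: `J_G(F_X̂) ∘ J_G(F_X) = ρ((-1)^g · 1)`** — the
composite of the two Fourier isomorphisms `J_G^q(X) → J_G^{q+(g-p)}(X̂) → J_G^{q+(g-p)+(g-m)}(X̂̂)` (`= J_G^q(X̂̂)`)
is multiplication by `(-1)^g` followed by the identification of lattice coordinates `dx_I ↔ dẑ_I` (the functor
`J_G`, `mapMatrix_mapMatrix`, applied to `F_X̂ · F_X = (-1)^g · 1`).
[cite: Lange2023AbelianVarietiesComplex, §6.2.3 Thm. 6.2.15 (p. 307)] [cite: VoisinHodgeI2002, §12.1.1 Rem. 12.3 (PDF p. 240)] -/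
theorem mapMatrix_griffithsPeriod_fourierMatrix_dualPeriod_fourierMatrix
    (t : ComplexTorus (griffithsPeriod (hodgeStructure Φ p) q hq (monomialBasis Φ p))) :
    mapMatrix (griffithsPeriod (hodgeStructure (dualPeriod Φ) m) (q + ((g : ℤ) - p)) (fourierLevel_eq hg q hq)
          (monomialBasis (dualPeriod Φ) m))
        (griffithsPeriod (hodgeStructure (dualPeriod (dualPeriod Φ)) p) (q + ((g : ℤ) - p) + ((g : ℤ) - m))
          (fourierLevel_eq (add_self_eq_swap hg) (q + ((g : ℤ) - p)) (fourierLevel_eq hg q hq))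
          (monomialBasis (dualPeriod (dualPeriod Φ)) p)) (fourierMatrix (dualPeriod Φ) e')
        (mapMatrix (griffithsPeriod (hodgeStructure Φ p) q hq (monomialBasis Φ p))
          (griffithsPeriod (hodgeStructure (dualPeriod Φ) m) (q + ((g : ℤ) - p)) (fourierLevel_eq hg q hq)
            (monomialBasis (dualPeriod Φ) m)) (fourierMatrix Φ e) t) =
      mapMatrix (griffithsPeriod (hodgeStructure Φ p) q hq (monomialBasis Φ p))
        (griffithsPeriod (hodgeStructure (dualPeriod (dualPeriod Φ)) p) (q + ((g : ℤ) - p) + ((g : ℤ) - m))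
          (fourierLevel_eq (add_self_eq_swap hg) (q + ((g : ℤ) - p)) (fourierLevel_eq hg q hq))
          (monomialBasis (dualPeriod (dualPeriod Φ)) p)) ((-1) ^ g • (1 : Matrix _ _ ℤ)) t := by
  exact (mapMatrix_mapMatrix _ _ t).trans (congrArg (fun M ↦ mapMatrix
    (griffithsPeriod (hodgeStructure Φ p) q hq (monomialBasis Φ p))
    (griffithsPeriod (hodgeStructure (dualPeriod (dualPeriod Φ)) p) (q + ((g : ℤ) - p) + ((g : ℤ) - m))
      (fourierLevel_eq (add_self_eq_swap hg) (q + ((g : ℤ) - p)) (fourierLevel_eq hg q hq))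
      (monomialBasis (dualPeriod (dualPeriod Φ)) p)) M t) (fourierMatrix_dualPeriod_mul_fourierMatrix Φ e e' hg))

end Griffiths

/-! ## §3 Theorem 6.2.15 on Weil's intermediate Jacobians -/

section Weil

variable (hp : Odd (p : ℤ))

/-- **Theorem 6.2.15 on Weil's Jacobians: `J_W(F_X̂) ∘ J_W(F_X) = ρ((-1)^g · 1)`** on
`J_W(Hᵖ(X)) → J_W(Hᵐ(X̂)) → J_W(Hᵖ(X̂̂))` (`p`, `m` odd).
[cite: Lange2023AbelianVarietiesComplex, §6.2.3 Thm. 6.2.15 (p. 307)] [cite: VoisinHodgeI2002, §12.1.1 Rem. 12.3 (PDF p. 240)] -/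
theorem mapMatrix_weilMinusCPeriod_fourierMatrix_dualPeriod_fourierMatrix
    (t : ComplexTorus (weilMinusCPeriod (hodgeStructure Φ p) hp (monomialBasis Φ p))) :
    mapMatrix (weilMinusCPeriod (hodgeStructure (dualPeriod Φ) m) (odd_of_add_eq_two_mul rfl hg hp)
          (monomialBasis (dualPeriod Φ) m))
        (weilMinusCPeriod (hodgeStructure (dualPeriod (dualPeriod Φ)) p)
          (odd_of_add_eq_two_mul rfl (add_self_eq_swap hg) (odd_of_add_eq_two_mul rfl hg hp))
          (monomialBasis (dualPeriod (dualPeriod Φ)) p)) (fourierMatrix (dualPeriod Φ) e')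
        (mapMatrix (weilMinusCPeriod (hodgeStructure Φ p) hp (monomialBasis Φ p))
          (weilMinusCPeriod (hodgeStructure (dualPeriod Φ) m) (odd_of_add_eq_two_mul rfl hg hp)
            (monomialBasis (dualPeriod Φ) m)) (fourierMatrix Φ e) t) =
      mapMatrix (weilMinusCPeriod (hodgeStructure Φ p) hp (monomialBasis Φ p))
        (weilMinusCPeriod (hodgeStructure (dualPeriod (dualPeriod Φ)) p)
          (odd_of_add_eq_two_mul rfl (add_self_eq_swap hg) (odd_of_add_eq_two_mul rfl hg hp))
          (monomialBasis (dualPeriod (dualPeriod Φ)) p)) ((-1) ^ g • (1 : Matrix _ _ ℤ)) t := by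
  exact (mapMatrix_mapMatrix _ _ t).trans (congrArg (fun M ↦ mapMatrix
    (weilMinusCPeriod (hodgeStructure Φ p) hp (monomialBasis Φ p))
    (weilMinusCPeriod (hodgeStructure (dualPeriod (dualPeriod Φ)) p)
      (odd_of_add_eq_two_mul rfl (add_self_eq_swap hg) (odd_of_add_eq_two_mul rfl hg hp))
      (monomialBasis (dualPeriod (dualPeriod Φ)) p)) M t) (fourierMatrix_dualPeriod_mul_fourierMatrix Φ e e' hg))

end Weil

end ComplexTorus

end Literature.Geometry.Kaehler

end
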